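import Summits.CriticalPhenomena.SAWScalingLimit.Theorems.SAWLoopFugacityFlowAvoidanceLimitExcursionRatioGreen
import Literature.Probability.LatticeModels.LatticeLaplacian

/-!
# Harmonicity for the `Ω_δ`-walk versus lattice harmonicity: the induced (site-killed) sub-case
— helper file 2 of stub `stub_ratioOscillation` (S3b-BHP) of line `symplectic-fermion-anchor`
(crux `SAWLoopFugacityFlow.AvoidanceLimit`, stmt-CriticalPhenomena-10649)

The reduction `stub_ratioOscillation_of_uniformBHP` (helper file 1,
`…RatioOscillationReduction.lean`) phrases harmonicity for the killed walk of `Ω_δ` as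
`P h = h`, `P = ¼·adjMat H Λ`, `H = discreteDomainGraph Ω δ`, `Λ = meshDomainFinset Ω δ` — the
simple random walk on `ℤ²` killed on the EDGES that are not edges of `H`. The printed uniform
boundary Harnack principle (Chelkak–Wan 2021, Cor. 3.8; vendored statement-only as
`Literature/Probability/LatticeModels/DiscreteBoundaryHarnack.lean`) is for the SITE-killed walk:
functions `h : ℤ² → ℝ` with `Δ h = 0` on a finite `S ⊆ ℤ²` (`IsLatticeHarmonicOn`,
`LatticeLaplacian.lean`), the values off `S` being the boundary data. This file proves the
dictionary between the two notions in the one case where they agree — when `H` is INDUCED on `Λ`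
by `ℤ²` (every lattice edge between two vertices of `Λ` is an edge of `H`):

* `transition_mulVec_eq_iff_latticeLaplacian_eq_zero` — if `H` is induced on `Λ` at `x`, then
  `(P h)(x) = h(x)` iff the zero extension of `h` off `Λ` has `Δ = 0` at `x`;
* `discreteDomainGraph_adj_iff_of_convex` — `Ω_δ` IS induced on `Λ` whenever `Ω` is CONVEX and
  bounded and `δ > 0` (the closed segment between two mesh points of `Ω` lies in `Ω ⊆ closure Ω`);
* the registered closing theorem `transition_mulVec_eq_iff_isLatticeHarmonicOn_of_convex`: for
  convex bounded `Ω` and `δ > 0`, `h : Λ → ℝ` is `P`-harmonic on `T ⊆ Λ` iff its zero extension is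
  lattice harmonic on `T`.

For non-convex (e.g. general Jordan) `Ω`, two vertices of `Ω_δ` at distance `δ` may be unjoined
(a lattice edge whose closed segment leaves `closure Ω` is deleted) and the site dictionary FAILS —
the `(V^Ω, E^Ω_int)` setting of Chelkak 2016, §2.2, which the printed theorems do not cover; nothing
is claimed about it here.

Sources: folklore; [ChelkakWan2021] §2.1 (site-killed discrete domains); [Chelkak2016] §2.2.
No definitions.
-/

noncomputable section

open scoped BigOperators Classical
open Finset
open Literature.Probability.RandomPlanarGeometry Literature.Probability.LatticeModels

namespace Summit.CriticalPhenomena.SAWScalingLimit.Theorems.AvoidanceLimit.Anchor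

open KilledGreen

/-- **Edge-killed = site-killed harmonicity in the induced case.** If `H` is induced on `Λ` by `ℤ²`
at `x ∈ Λ` (`H.Adj x y ↔ x ∼_{ℤ²} y ∧ y ∈ Λ`), then for `h : Λ → ℝ`: `(P h)(x) = h(x)`
(`P = ¼·adjMat H Λ`) iff the zero extension of `h` off `Λ` has vanishing lattice Laplacian at `x`.
[folklore] -/
theorem transition_mulVec_eq_iff_latticeLaplacian_eq_zero {H : SimpleGraph (Site 2)}
    {Λ : Finset (Site 2)} (x : Λ) (hind : ∀ y : Site 2, H.Adj x y ↔ (zdGraph 2).Adj x y ∧ y ∈ Λ)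
    (h : Λ → ℝ) :
    Matrix.mulVec ((4 : ℝ)⁻¹ • adjMat H Λ) h x = h x ↔
      latticeLaplacian (fun v => if hv : v ∈ Λ then h ⟨v, hv⟩ else 0) x = 0 := by
  set hext : Site 2 → ℝ := fun v => if hv : v ∈ Λ then h ⟨v, hv⟩ else 0 with hext_def
  have hx : hext x = h x := by simp [hext_def]
  -- the `H`-neighbours of `x` in `Λ`, pushed to `Site 2`, are `ℤ²`-neighbours
  have hsub : (univ.filter (fun y : Λ => H.Adj x.1 y.1)).map (Function.Embedding.subtype _) ⊆
      (zdGraph 2).neighborFinset x.1 := by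
    intro z hz
    rw [Finset.mem_map] at hz
    obtain ⟨y, hy, rfl⟩ := hz
    rw [Finset.mem_filter] at hy
    rw [SimpleGraph.mem_neighborFinset]
    exact ((hind y).1 hy.2).1
  -- the remaining `ℤ²`-neighbours are off `Λ`, where the zero extension vanishes
  have hzero : ∀ z ∈ (zdGraph 2).neighborFinset x.1,
      z ∉ (univ.filter (fun y : Λ => H.Adj x.1 y.1)).map (Function.Embedding.subtype _) →
      hext z = 0 := by
    intro z hz hzn
    by_cases hzΛ : z ∈ Λ
    · exfalso
      apply hzn
      rw [Finset.mem_map]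
      refine ⟨⟨z, hzΛ⟩, ?_, rfl⟩
      rw [Finset.mem_filter]
      exact ⟨Finset.mem_univ _, (hind z).2 ⟨(SimpleGraph.mem_neighborFinset _ _ _).1 hz, hzΛ⟩⟩
    · simp [hext_def, hzΛ]
  -- the `P`-average is a quarter of the lattice-neighbour sum of the zero extension
  have key : Matrix.mulVec ((4 : ℝ)⁻¹ • adjMat H Λ) h x =
      (4 : ℝ)⁻¹ * ∑ z ∈ (zdGraph 2).neighborFinset (x : Site 2), hext z := by
    have h1 : ∑ y ∈ univ.filter (fun y : Λ => H.Adj x.1 y.1), h y =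
        ∑ z ∈ (univ.filter (fun y : Λ => H.Adj x.1 y.1)).map (Function.Embedding.subtype _),
          hext z := by
      rw [Finset.sum_map]
      refine Finset.sum_congr rfl fun y _ => ?_
      simp [hext_def]
    have h2 := transition_mulVec_apply H Λ h x
    rw [h1, Finset.sum_subset hsub hzero] at h2
    exact h2
  -- the `cornerUnit` enumeration of the four lattice neighbours (cf. the identical computation
  -- `sum_cornerUnit_eq_sum_neighborFinset` of `…InteriorRatioLimitSubharmonic.lean`)
  have hsum : ∑ k : Fin 4, hext (x + cornerUnit k) =
      ∑ z ∈ (zdGraph 2).neighborFinset (x : Site 2), hext z := by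
    rw [sum_neighborFinset_zdGraph_two, Fin.sum_univ_four]
    have h0 : (cornerUnit 0 : Site 2) = Pi.single 0 1 := rfl
    have h1 : (cornerUnit 1 : Site 2) = Pi.single 1 1 := rfl
    have h2 : (cornerUnit 2 : Site 2) = Pi.single 0 (-1) := by
      rw [Pi.single_neg]; rfl
    have h3 : (cornerUnit 3 : Site 2) = Pi.single 1 (-1) := by
      rw [Pi.single_neg]; rfl
    rw [h0, h1, h2, h3]
    ring
  rw [key, latticeLaplacian_eq, hsum, hx]
  constructor <;> intro hh <;> linarith

/-- **A convex domain is discretised by an INDUCED graph**: for convex bounded `Ω` and `δ > 0`, two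
vertices of `Λ = meshDomainFinset Ω δ` are joined in `Ω_δ = discreteDomainGraph Ω δ` iff they are
lattice neighbours (the closed segment between their mesh points lies in the convex set
`Ω ⊆ closure Ω`, so no edge is deleted). [folklore] -/
theorem discreteDomainGraph_adj_iff_of_convex {Ω : Set ℂ} (hΩc : Convex ℝ Ω)
    (hΩ : Bornology.IsBounded Ω) {δ : ℝ} (hδ : 0 < δ) {x : Site 2} (hx : x ∈ meshDomainFinset Ω δ)
    (y : Site 2) :
    (discreteDomainGraph Ω δ).Adj x y ↔ (zdGraph 2).Adj x y ∧ y ∈ meshDomainFinset Ω δ := by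
  have hxD : x ∈ meshDomain Ω δ := by
    rwa [← Finset.mem_coe, coe_meshDomainFinset hΩ hδ] at hx
  constructor
  · intro h
    obtain ⟨hm, -, hy⟩ := discreteDomainGraph_adj_iff.1 h
    refine ⟨meshGraph_le_zdGraph Ω δ hm, ?_⟩
    rw [← Finset.mem_coe, coe_meshDomainFinset hΩ hδ]
    exact hy
  · rintro ⟨hadj, hy⟩
    have hyD : y ∈ meshDomain Ω δ := by
      rwa [← Finset.mem_coe, coe_meshDomainFinset hΩ hδ] at hy
    refine discreteDomainGraph_adj_iff.2 ⟨meshGraph_adj_iff.2 ⟨hadj, ?_⟩, hxD, hyD⟩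
    exact (hΩc.segment_subset (meshDomain_subset_meshVertices Ω δ hxD)
      (meshDomain_subset_meshVertices Ω δ hyD)).trans subset_closure

/-- **Registered closing theorem of this helper file: the site dictionary for convex domains.**
For convex bounded `Ω` and `δ > 0`, a function `h` on `Λ = meshDomainFinset Ω δ` is harmonic for the
killed walk of `Ω_δ` (`P h = h`, `P = ¼·adjMat (discreteDomainGraph Ω δ) Λ`) at the vertices of
`T ⊆ Λ` iff its zero extension off `Λ` is lattice harmonic on `T` (`IsLatticeHarmonicOn`, the
site-killed notion of the printed boundary Harnack principle) — because `Ω_δ` is then induced on `Λ`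
by `ℤ²`. [folklore] -/
theorem transition_mulVec_eq_iff_isLatticeHarmonicOn_of_convex :
    ∀ (Ω : Set ℂ) (δ : ℝ), Convex ℝ Ω → Bornology.IsBounded Ω → 0 < δ →
      ∀ (h : ↥(meshDomainFinset Ω δ) → ℝ) (T : Set (Site 2)), T ⊆ ↑(meshDomainFinset Ω δ) →
      (IsLatticeHarmonicOn (fun v => if hv : v ∈ meshDomainFinset Ω δ then h ⟨v, hv⟩ else 0) T ↔
        ∀ x : ↥(meshDomainFinset Ω δ), (x : Site 2) ∈ T →
          Matrix.mulVec ((4 : ℝ)⁻¹ • adjMat (discreteDomainGraph Ω δ) (meshDomainFinset Ω δ)) h x =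
            h x) := by
  intro Ω δ hΩc hΩ hδ h T hT
  have hind : ∀ x : ↥(meshDomainFinset Ω δ), ∀ y : Site 2,
      (discreteDomainGraph Ω δ).Adj x y ↔ (zdGraph 2).Adj x y ∧ y ∈ meshDomainFinset Ω δ :=
    fun x y => discreteDomainGraph_adj_iff_of_convex hΩc hΩ hδ x.2 y
  constructor
  · intro hh x hxT
    exact (transition_mulVec_eq_iff_latticeLaplacian_eq_zero x (hind x) h).2 (hh x hxT)
  · intro hh v hv
    exact (transition_mulVec_eq_iff_latticeLaplacian_eq_zero ⟨v, hT hv⟩ (hind ⟨v, hT hv⟩) h).1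
      (hh ⟨v, hT hv⟩ hv)

end Summit.CriticalPhenomena.SAWScalingLimit.Theorems.AvoidanceLimit.Anchor

end
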